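import Mathlib
import HarnessLib
import Summits.KontsevichZagierPeriods.Zeta5Search.Denom.TwoTaleP15Forms
import Summits.KontsevichZagierPeriods.Zeta5Search.Denom.CatalanRayPClosedInt

/-!
# TwoTaleP15SavingAPI — prime-by-prime API of the saving product `Φ̃ₙ` (for proofs of the `Inclusion` input)

HONEST FRAMING: systematic search; no irrationality claim unless certified.

fam-denom (pub-zeta5), FAMILY.md §6 D16.  `TwoTaleP15Saving.savingProduct n = ∏_{i<20} ∏ {p ∈ classPrimes 26 (15·) (ivl i) n}`
is a product of twenty (overlapping) class-prime products.  Arithmetic proofs of `TwoTaleP15Forms.Inclusion` (Zudilin's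
Lemmas 7–8 at P15) argue ONE PRIME AT A TIME; this file regroups `Φ̃ₙ` accordingly (all PROVED, no inputs):

* `mem_classPrimes_ivl_iff` — `p` is counted in interval `i` iff `p` prime, `p ≤ 15n`, `26n < p²`, `uᵢ ≤ {n/p} < vᵢ`
  (`{n/p} = (n % p)/p`: Mathlib `Int.fract_div_natCast_eq_div_natCast_mod`);
* `ivlMult n p = #{i < 20 : p ∈ class i}` (= `φ̃(n/p) ∈ {0,1,2}` on the counted primes) and
  **`factorization_savingProduct : (Φ̃ₙ).factorization p = ivlMult n p`**, `padicValNat_savingProduct`;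
* **`savingProduct_dvd_iff : Φ̃ₙ ∣ M ↔ ∀ p prime, ivlMult n p ≤ v_p(M)`** (`M ≠ 0`), the `ℤ` version, and
  `savingProduct_dvd_int_of_prime_pow_dvd : (∀ p prime, p^{ivlMult n p} ∣ z) → Φ̃ₙ ∣ z`;
* `padicValRat_div_savingProduct : v_p(x/Φ̃ₙ) = v_p(x) − ivlMult n p` (a rational with all valuations `≥ 0` is an
  integer: the tree's `Denom.CatalanRayPClosed.exists_int_of_padicValRat_nonneg`, reused);
* the two bridges **`inclusion_of_dvd`** and **`inclusion_of_padicValRat_nonneg`** `… → TwoTaleP15Forms.Inclusion`.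
-/

noncomputable section

open Finset
open Literature.NumberTheory.DiophantineApproximation.RhinViola
open Summit.KontsevichZagierPeriods.Zeta5Search.Denom.TwoTaleP15Saving
open Summit.KontsevichZagierPeriods.Zeta5Search.Denom.TwoTaleP15Forms

namespace Summit.KontsevichZagierPeriods.Zeta5Search.Denom.TwoTaleP15SavingAPI

/-! ### Membership and the plain product -/

/-- A prime `p` is counted in the digit interval `ivl i = [uᵢ, vᵢ)` at `n` iff `p ≤ 15n`, `26n < p²` and
`uᵢ ≤ {n/p} < vᵢ`. -/
theorem mem_classPrimes_ivl_iff {i n p : ℕ} :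
    p ∈ classPrimes 26 primeCut (ivl i) n ↔
      p.Prime ∧ p ≤ 15 * n ∧ (26 : ℝ) * n < (p : ℝ) ^ 2 ∧
        (ivl i).1 ≤ Int.fract ((n : ℝ) / p) ∧ Int.fract ((n : ℝ) / p) < (ivl i).2 := by
  simp only [classPrimes, primeCut, mem_filter, mem_range]
  constructor
  · rintro ⟨h1, h2, h3, h4, h5⟩
    exact ⟨h2, by omega, h3, h4, h5⟩
  · rintro ⟨h2, h1, h3, h4, h5⟩
    exact ⟨by omega, h2, h3, h4, h5⟩

/-- `ivlProduct i n` is the plain product of the primes of class `i`. -/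
theorem ivlProduct_eq (i n : ℕ) : ivlProduct i n = ∏ p ∈ classPrimes 26 primeCut (ivl i) n, p := by
  simp [ivlProduct, classPrimeProduct, Finset.singleton_biUnion]

/-- **Multiplicity of `p` in `Φ̃ₙ`**: the number of the twenty digit intervals whose class contains `p`
(`= φ̃(n/p)` for a prime `p ≤ 15n`, `p² > 26n`; `0` otherwise). -/
def ivlMult (n p : ℕ) : ℕ := ((range 20).filter fun i => p ∈ classPrimes 26 primeCut (ivl i) n).card

/-- `ivlMult n p ≤ 20` (trivially). -/
theorem ivlMult_le (n p : ℕ) : ivlMult n p ≤ 20 :=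
  (card_filter_le _ _).trans (by simp)

/-- A non-prime has multiplicity `0`. -/
theorem ivlMult_eq_zero_of_not_prime {n p : ℕ} (hp : ¬ p.Prime) : ivlMult n p = 0 := by
  rw [ivlMult, card_eq_zero, filter_eq_empty_iff]
  intro i _ h
  exact hp (prime_of_mem_classPrimes h)

/-! ### Factorization of `Φ̃ₙ` -/

/-- `v_p` of one class product: `1` if `p` is in the class, else `0`. -/
theorem factorization_ivlProduct (i n p : ℕ) :
    (ivlProduct i n).factorization p = if p ∈ classPrimes 26 primeCut (ivl i) n then 1 else 0 := by
  rw [ivlProduct_eq, Nat.factorization_prod fun q hq => (prime_of_mem_classPrimes hq).ne_zero,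
    Finsupp.finsetSum_apply]
  have h : ∀ q ∈ classPrimes 26 primeCut (ivl i) n, q.factorization p = if q = p then 1 else 0 :=
    fun q hq => by rw [(prime_of_mem_classPrimes hq).factorization, Finsupp.single_apply]
  rw [sum_congr rfl h, sum_ite_eq']

/-- **`(Φ̃ₙ).factorization p = ivlMult n p`.** -/
theorem factorization_savingProduct (n p : ℕ) : (savingProduct n).factorization p = ivlMult n p := by
  rw [savingProduct, Nat.factorization_prod fun i _ => (ivlProduct_pos i n).ne', Finsupp.finsetSum_apply]
  simp_rw [factorization_ivlProduct]
  rw [ivlMult, card_filter]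

/-- `v_p(Φ̃ₙ) = ivlMult n p` for a prime `p`. -/
theorem padicValNat_savingProduct {n p : ℕ} (hp : p.Prime) : padicValNat p (savingProduct n) = ivlMult n p := by
  rw [← Nat.factorization_def _ hp, factorization_savingProduct]

/-! ### Divisibility criteria -/

/-- **`Φ̃ₙ ∣ M ↔ ∀ p prime, ivlMult n p ≤ v_p(M)`** (`M ≠ 0`). -/
theorem savingProduct_dvd_iff {n M : ℕ} (hM : M ≠ 0) :
    savingProduct n ∣ M ↔ ∀ p : ℕ, p.Prime → ivlMult n p ≤ padicValNat p M := by
  rw [← Nat.factorization_le_iff_dvd (savingProduct_pos n).ne' hM, Finsupp.le_def]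
  constructor
  · intro h p hp
    have h' := h p
    rwa [factorization_savingProduct, Nat.factorization_def _ hp] at h'
  · intro h p
    by_cases hp : p.Prime
    · rw [factorization_savingProduct, Nat.factorization_def _ hp]; exact h p hp
    · rw [Nat.factorization_eq_zero_of_not_prime _ hp]; exact Nat.zero_le _

/-- The same over `ℤ`: `Φ̃ₙ ∣ z ↔ ∀ p prime, ivlMult n p ≤ v_p(z)` (`z ≠ 0`). -/
theorem savingProduct_dvd_int_iff {n : ℕ} {z : ℤ} (hz : z ≠ 0) :
    (savingProduct n : ℤ) ∣ z ↔ ∀ p : ℕ, p.Prime → ivlMult n p ≤ padicValInt p z := by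
  rw [Int.natCast_dvd, savingProduct_dvd_iff (Int.natAbs_ne_zero.2 hz)]
  simp only [padicValInt]

/-- **Prime powers suffice:** if `p ^ ivlMult n p ∣ z` for every prime `p`, then `Φ̃ₙ ∣ z`. -/
theorem savingProduct_dvd_int_of_prime_pow_dvd {n : ℕ} {z : ℤ}
    (h : ∀ p : ℕ, p.Prime → (p : ℤ) ^ ivlMult n p ∣ z) : (savingProduct n : ℤ) ∣ z := by
  rcases eq_or_ne z 0 with rfl | hz
  · exact dvd_zero _
  rw [savingProduct_dvd_int_iff hz]
  intro p hp
  haveI := Fact.mk hp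
  exact ((padicValInt_dvd_iff _ _).1 (h p hp)).resolve_left hz

/-- `v_p(x / Φ̃ₙ) = v_p(x) − ivlMult n p` for `x ≠ 0`. -/
theorem padicValRat_div_savingProduct {n p : ℕ} (hp : p.Prime) {x : ℚ} (hx : x ≠ 0) :
    padicValRat p (x / savingProduct n) = padicValRat p x - ivlMult n p := by
  haveI := Fact.mk hp
  have hΦ : (savingProduct n : ℚ) ≠ 0 := by exact_mod_cast (savingProduct_pos n).ne'
  rw [padicValRat.div hx hΦ, ← padicValRat_of_nat, padicValNat_savingProduct hp]

/-! ### Bridges to `Inclusion` -/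

/-- **Bridge 1.** Prime-power divisibility for the `q`-side and an integer witness for the `p`-side give `Inclusion`. -/
theorem inclusion_of_dvd
    (hq : ∀ n : ℕ, 1 ≤ n → ∀ p : ℕ, p.Prime → (p : ℤ) ^ ivlMult n p ∣ ((lcmNormaliser n : ℕ) : ℤ) * formQ n)
    (hp : ∀ n : ℕ, 1 ≤ n → ∃ A : ℤ, ((lcmNormaliser n : ℕ) : ℚ) * formP n = (savingProduct n : ℚ) * A) :
    Inclusion := fun n hn =>
  ⟨by obtain ⟨B, hB⟩ := savingProduct_dvd_int_of_prime_pow_dvd (hq n hn); exact ⟨B, hB⟩, hp n hn⟩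

/-- **Bridge 2.** Non-negative valuations of `D₁₆ₙD₁₅ₙqₙ/Φ̃ₙ` and `D₁₆ₙD₁₅ₙpₙ/Φ̃ₙ` at every prime give `Inclusion`. -/
theorem inclusion_of_padicValRat_nonneg
    (h : ∀ n : ℕ, 1 ≤ n → ∀ p : ℕ, p.Prime →
      0 ≤ padicValRat p (((lcmNormaliser n : ℕ) : ℚ) * formQ n / savingProduct n) ∧
        0 ≤ padicValRat p (((lcmNormaliser n : ℕ) : ℚ) * formP n / savingProduct n)) :
    Inclusion := by
  intro n hn
  have hΦ : (savingProduct n : ℚ) ≠ 0 := by exact_mod_cast (savingProduct_pos n).ne'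
  obtain ⟨B, hB⟩ := CatalanRayPClosed.exists_int_of_padicValRat_nonneg _ fun p hp => (h n hn p hp).1
  obtain ⟨A, hA⟩ := CatalanRayPClosed.exists_int_of_padicValRat_nonneg _ fun p hp => (h n hn p hp).2
  rw [eq_div_iff hΦ] at hB hA
  refine ⟨⟨B, ?_⟩, ⟨A, by rw [← hA]; ring⟩⟩
  have e : (((lcmNormaliser n : ℕ) : ℤ) * formQ n : ℤ) = ((savingProduct n : ℤ) * B : ℤ) := by
    have e' : (((lcmNormaliser n : ℕ) : ℚ)) * formQ n = (savingProduct n : ℚ) * B := by rw [← hB]; ring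
    exact_mod_cast e'
  exact e

end Summit.KontsevichZagierPeriods.Zeta5Search.Denom.TwoTaleP15SavingAPI

end
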